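import Literature.Geometry.Lorentzian.SenWittenOperator
import HarnessLib

/-!
# The spin representation of `so(3)` in the Pauli model is a Lie algebra homomorphism

Pure-algebra sub-brick (ii-a) of the Lichnerowicz identity in a frame (brick B1a of the analytic
engine of Witten's proof of the positive energy theorem, `SenWittenOperator.lean`). The spin
connection form of a frame is `A(v) = −¼ Σₖₗ ω_{kl}(v) σₖσₗ` with `ω(v)` antisymmetric; the
quadratic (`A ∧ A`) part of its curvature matches the quadratic (`ω ∧ ω`) part of the Riemann
curvature in the frame because `a ↦ −¼ Σ a_{kl} σₖσₗ` is a Lie algebra homomorphism from the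
antisymmetric `3 × 3` matrices (with the bracket `[a, b]_{kl} = Σₘ (a_{km} b_{lm} − b_{km} a_{lm})`
`= (ab⊤ − ba⊤)_{kl}`, the combination produced by the structure equation
`dω_{kl}(U, W) = R_{kl}(U, W) + Σₘ (ω_{km}(W) ω_{lm}(U) − ω_{km}(U) ω_{lm}(W))`) to the
endomorphisms of the spinor space (Lawson–Michelsohn, *Spin Geometry*, Prop. I.6.2 and
Thm. II.4.14).

* `SenWitten.spinRep_bracket` — for antisymmetric `a, b`:
  `A_a(A_b u) − A_b(A_a u) = −¼ Σₖₗ (Σₘ (a_{km} b_{lm} − b_{km} a_{lm})) σₖσₗ u`,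
  where `A_a u = −¼ Σ a_{kl} σₖσₗ u`.

All proved (expansion of the finitely many Pauli words); no definitions, no named facts.

## References

* H. B. Lawson, M.-L. Michelsohn, *Spin Geometry*, Princeton 1989, Prop. I.6.2, Thm. II.4.14.
  [LawsonMichelsohn1989]
* T. Parker, C. H. Taubes, *On Witten's proof of the positive energy theorem*, Comm. Math. Phys.
  84 (1982) 223–238, §3. [ParkerTaubes1982]
-/

noncomputable section

open Finset
open scoped RealInnerProductSpace

namespace Literature.Geometry.Lorentzian

namespace SenWitten

open PauliModel

/-- **The spin representation is a Lie algebra homomorphism** (Pauli model, brute force): for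
antisymmetric `a, b : Fin 3 → Fin 3 → ℝ` and `A_a u = −¼ Σₖₗ a_{kl} σₖσₗu`,
`A_a(A_b u) − A_b(A_a u) = −¼ Σₖₗ (Σₘ (a_{km}b_{lm} − b_{km}a_{lm})) σₖσₗ u`.
Lawson–Michelsohn 1989, Prop. I.6.2. [cite: LawsonMichelsohn1989, Prop. I.6.2] -/
theorem spinRep_bracket (a b : Fin 3 → Fin 3 → ℝ) (ha : ∀ i j, a j i = -a i j)
    (hb : ∀ i j, b j i = -b i j) (u : Spinor) :
    (-((1 / 4 : ℝ) • ∑ k, ∑ l, a k l • pauli k (pauli l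
        (-((1 / 4 : ℝ) • ∑ m, ∑ n, b m n • pauli m (pauli n u)))))) -
      (-((1 / 4 : ℝ) • ∑ k, ∑ l, b k l • pauli k (pauli l
        (-((1 / 4 : ℝ) • ∑ m, ∑ n, a m n • pauli m (pauli n u)))))) =
      -((1 / 4 : ℝ) • ∑ k, ∑ l, (∑ m, (a k m * b l m - b k m * a l m)) • pauli k (pauli l u)) := by
  have had : ∀ i, a i i = 0 := fun i ↦ by linarith [ha i i]
  have hbd : ∀ i, b i i = 0 := fun i ↦ by linarith [hb i i]
  have a10 : a 1 0 = -a 0 1 := ha 0 1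
  have a20 : a 2 0 = -a 0 2 := ha 0 2
  have a21 : a 2 1 = -a 1 2 := ha 1 2
  have b10 : b 1 0 = -b 0 1 := hb 0 1
  have b20 : b 2 0 = -b 0 2 := hb 0 2
  have b21 : b 2 1 = -b 1 2 := hb 1 2
  have hsq := pauli_sq
  have ha01 := pauli_anticomm (show (0 : Fin 3) ≠ 1 by decide)
  have ha02 := pauli_anticomm (show (0 : Fin 3) ≠ 2 by decide)
  have ha12 := pauli_anticomm (show (1 : Fin 3) ≠ 2 by decide)
  simp only [Fin.sum_univ_three, had, hbd, a10, a20, a21, b10, b20, b21, zero_smul, zero_add,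
    add_zero, hsq, ha01, ha02, ha12, map_neg, map_add, map_smul, smul_neg, neg_smul, neg_neg,
    smul_add, mul_zero, zero_mul, sub_zero, mul_neg, neg_mul]
  module

end SenWitten

end Literature.Geometry.Lorentzian

end
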